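import Literature.LinearAlgebra.Matrix.UnitaryThreeMinimalNilpotentWitt     -- ★ p852074 (E): `single_zero_two_mem_iff`, `antidiagonal_three_mul_self`, …
import Literature.LinearAlgebra.Matrix.MinimalNilpotentSliceFinThree         -- ★ p852027/p852096 (D): transversality, `range (ad E₂₀)` section ∕ injectivity
import HarnessLib

/-!
# The Slodowy slice chart at the minimal nilpotent DESCENDED TO THE REAL FORM: on the trace-zero unitary Lie algebra `𝔲₀ = {X | ᵗ(σX) J₃ + J₃ X = 0, tr X = 0}`
# the map `(Y, Z) ↦ 2·(N Y − Y N) + Z` is an additive BIJECTION `(𝔲₀ ∩ range (ad N⁻)) × (𝔲₀ ∩ 𝔷(N⁻)) ≃ 𝔲₀` (`N = c·E₀₂`, `σ c = −c`, `N⁻ ∝ E₂₀`)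

Topic `LinearAlgebra/Matrix`; namespace `Literature.LinearAlgebra.Matrix.UnitaryThreeSliceDescent`.  THEOREMS ONLY (no definition ∕ instance ∕ notation ∕ named fact ∕ `sorry`).
Brick (D4d-F) «θ-STABLE DESCENT» of the `hodgecm-mathlib` cell's ROAD «HC-D» (crux H413 = `stmt-HodgeConjecture-24833`; count-neutral), written for the analytic brick D5(iii)
(A-p12 (g29)): over the field `E = K` the transversal pair `(Q_K, C_K) = (range (ad E₂₀), 𝔷(E₂₀))` of ★ `MinimalNilpotentSliceFinThree` §4∕§6 gives `M₃(K) = ⁅N, Q_K⁆ ⊕ C_K` with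
`ad N` injective on `Q_K`; both are stable under the involution `θ Y = −J₃ ᵗ(σY) J₃` whose fixed points are the unitary Lie algebra, so the decomposition DESCENDS to the fixed
points.  CARRIERS (road rule R3 — no definitions): the real form and the two pieces are ARBITRARY additive subgroups given by MEMBERSHIP HYPOTHESES
`h𝔲₀ : X ∈ 𝔲₀ ↔ ᵗ(σX) J₃ + J₃ X = 0 ∧ tr X = 0`, `hQ : Y ∈ Q ↔ Y ∈ 𝔲₀ ∧ (Y 0 1 = Y 0 2 = Y 1 1 = Y 1 2 = 0 ∧ Y 0 0 + Y 2 2 = 0)` (the entrywise description of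
`range (ad E₂₀)`, ★ (D) §6), `hC : Z ∈ C ↔ Z ∈ 𝔲₀ ∧ Z E₂₀ = E₂₀ Z`; sign∕scale convention = the consumer's (★ (U) `hasStrictFDerivAt_cayleyConj_add_elementwise`, D5(iii) A-p12): `(Y, Z) ↦ 2 • (N * Y − Y * N) + Z`.

* §1 `θ`-CALCULUS for `J₃` (any field): `theta_apply` (`(θY) i j = −σ (Y (rev j) (rev i))`), `theta_mul` (`θ(AB) = −θB·θA`), `theta_bracket` (`θ N = N ⇒ θ(NA − AN) = N·θA − θA·N`),
  `theta_theta`, `theta_smul`, `mem_iff_theta_eq` (`ᵗ(σX)J₃ + J₃X = 0 ↔ θ X = X`), `theta_single_zero_two` (`σ c = −c ⇒ θ(c·E₀₂) = c·E₀₂`), and the SHAPE lemmas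
  `theta_rangeShape`, `theta_comm_single_two_zero` (both pieces are `θ`-stable).
* §2 THE DESCENT (field `K`, `2 ≠ 0`, `c ≠ 0`, `σ c = −c`): `smul_bracket_mem` (`2•(NY − YN) ∈ 𝔲₀` for `Y ∈ 𝔲₀`), `slice_injective`, `slice_surjective`, and the ∃-bundle
  **`exists_slice_addEquiv : ∃ e : (↥Q × ↥C) ≃+ ↥𝔲₀, ∀ p, ↑(e p) = (2 : K) • (N * ↑p.1 − ↑p.1 * N) + ↑p.2`**.

## References
* [Humphreys1972] J. E. Humphreys, *Introduction to Lie Algebras and Representation Theory* (1972), §7.2 (the `𝔰𝔩₂`-module decomposition `𝔤 = ker (ad e) ⊕ range (ad f)`). Context locator;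
  the slice is Slodowy's (LNM 815 (1980) §7.4, named in prose only).
* [Rogawski1990] J. D. Rogawski, *Automorphic Representations of Unitary Groups in Three Variables* (1990), §1.9 p. 8 (the real form `𝔲` as `θ`-fixed points). Context locator.
-/

set_option autoImplicit false

open Matrix

namespace Literature.LinearAlgebra.Matrix.UnitaryThreeSliceDescent

/-! ## §1 `θ Y = −J₃ ᵗ(σY) J₃` -/

section Theta

variable {R : Type*} [Field R] (σ : R →+* R)

/-- ENTRIES of `θ Y = −J₃ ᵗ(σY) J₃`: `(θ Y) i j = −σ (Y j.rev i.rev)`. [cite: Rogawski1990, §1.9 p. 8] -/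
theorem theta_apply (Y : Matrix (Fin 3) (Fin 3) R) (i j : Fin 3) :
    (-(!![(0 : R), 0, 1; 0, 1, 0; 1, 0, 0] * (Y.map σ)ᵀ * !![(0 : R), 0, 1; 0, 1, 0; 1, 0, 0])) i j = -σ (Y j.rev i.rev) := by
  simp only [Matrix.neg_apply, Matrix.mul_apply, Matrix.transpose_apply, Matrix.map_apply, Fin.sum_univ_three]
  fin_cases i <;> fin_cases j <;> simp [Fin.rev]

/-- `θ` is ANTI-multiplicative up to sign: `θ (A B) = −(θ B · θ A)` (since `J₃² = 1`). [cite: Rogawski1990, §1.9 p. 8] -/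
theorem theta_mul (A B : Matrix (Fin 3) (Fin 3) R) :
    -(!![(0 : R), 0, 1; 0, 1, 0; 1, 0, 0] * ((A * B).map σ)ᵀ * !![(0 : R), 0, 1; 0, 1, 0; 1, 0, 0]) =
      -((-(!![(0 : R), 0, 1; 0, 1, 0; 1, 0, 0] * (B.map σ)ᵀ * !![(0 : R), 0, 1; 0, 1, 0; 1, 0, 0])) *
        (-(!![(0 : R), 0, 1; 0, 1, 0; 1, 0, 0] * (A.map σ)ᵀ * !![(0 : R), 0, 1; 0, 1, 0; 1, 0, 0]))) := by
  have hJJ : ∀ M : Matrix (Fin 3) (Fin 3) R, !![(0 : R), 0, 1; 0, 1, 0; 1, 0, 0] * (!![(0 : R), 0, 1; 0, 1, 0; 1, 0, 0] * M) = M := fun M => by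
    rw [← Matrix.mul_assoc, UnitaryThreeWitt.antidiagonal_three_mul_self, Matrix.one_mul]
  rw [Matrix.map_mul, Matrix.transpose_mul]
  simp only [Matrix.neg_mul, Matrix.mul_neg, neg_neg, Matrix.mul_assoc, hJJ]

/-- `θ (A + B) = θ A + θ B`. [cite: Rogawski1990, §1.9 p. 8] -/
theorem theta_add (A B : Matrix (Fin 3) (Fin 3) R) :
    -(!![(0 : R), 0, 1; 0, 1, 0; 1, 0, 0] * ((A + B).map σ)ᵀ * !![(0 : R), 0, 1; 0, 1, 0; 1, 0, 0]) =
      -(!![(0 : R), 0, 1; 0, 1, 0; 1, 0, 0] * (A.map σ)ᵀ * !![(0 : R), 0, 1; 0, 1, 0; 1, 0, 0]) +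
        -(!![(0 : R), 0, 1; 0, 1, 0; 1, 0, 0] * (B.map σ)ᵀ * !![(0 : R), 0, 1; 0, 1, 0; 1, 0, 0]) := by
  ext i j
  simp only [Matrix.neg_apply, Matrix.add_apply, Matrix.mul_apply, Matrix.transpose_apply, Matrix.map_apply, Fin.sum_univ_three, map_add]
  ring

/-- `θ (A + B) = θ A + θ B` and `θ (A − B) = θ A − θ B` (bookkeeping). [cite: Rogawski1990, §1.9 p. 8] -/
theorem theta_sub (A B : Matrix (Fin 3) (Fin 3) R) :
    -(!![(0 : R), 0, 1; 0, 1, 0; 1, 0, 0] * ((A - B).map σ)ᵀ * !![(0 : R), 0, 1; 0, 1, 0; 1, 0, 0]) =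
      -(!![(0 : R), 0, 1; 0, 1, 0; 1, 0, 0] * (A.map σ)ᵀ * !![(0 : R), 0, 1; 0, 1, 0; 1, 0, 0]) -
        -(!![(0 : R), 0, 1; 0, 1, 0; 1, 0, 0] * (B.map σ)ᵀ * !![(0 : R), 0, 1; 0, 1, 0; 1, 0, 0]) := by
  ext i j
  simp only [Matrix.neg_apply, Matrix.sub_apply, Matrix.mul_apply, Matrix.transpose_apply, Matrix.map_apply, Fin.sum_univ_three, map_sub]
  ring

/-- `θ` of a bracket with a `θ`-FIXED `N`: `θ (N A − A N) = N · θA − θA · N`. [cite: Rogawski1990, §1.9 p. 8] -/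
theorem theta_bracket {N : Matrix (Fin 3) (Fin 3) R} (hN : -(!![(0 : R), 0, 1; 0, 1, 0; 1, 0, 0] * (N.map σ)ᵀ * !![(0 : R), 0, 1; 0, 1, 0; 1, 0, 0]) = N)
    (A : Matrix (Fin 3) (Fin 3) R) :
    -(!![(0 : R), 0, 1; 0, 1, 0; 1, 0, 0] * ((N * A - A * N).map σ)ᵀ * !![(0 : R), 0, 1; 0, 1, 0; 1, 0, 0]) =
      N * (-(!![(0 : R), 0, 1; 0, 1, 0; 1, 0, 0] * (A.map σ)ᵀ * !![(0 : R), 0, 1; 0, 1, 0; 1, 0, 0])) -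
        (-(!![(0 : R), 0, 1; 0, 1, 0; 1, 0, 0] * (A.map σ)ᵀ * !![(0 : R), 0, 1; 0, 1, 0; 1, 0, 0])) * N := by
  rw [theta_sub, theta_mul, theta_mul, hN]
  abel

/-- `θ (θ Y) = Y` for an involutive `σ`. [cite: Rogawski1990, §1.9 p. 8] -/
theorem theta_theta (hσ : ∀ x, σ (σ x) = x) (Y : Matrix (Fin 3) (Fin 3) R) :
    -(!![(0 : R), 0, 1; 0, 1, 0; 1, 0, 0] * ((-(!![(0 : R), 0, 1; 0, 1, 0; 1, 0, 0] * (Y.map σ)ᵀ * !![(0 : R), 0, 1; 0, 1, 0; 1, 0, 0])).map σ)ᵀ *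
        !![(0 : R), 0, 1; 0, 1, 0; 1, 0, 0]) = Y := by
  ext i j
  rw [theta_apply, theta_apply]
  simp [hσ]

/-- `θ (r • Y) = σ r • θ Y`. [cite: Rogawski1990, §1.9 p. 8] -/
theorem theta_smul (r : R) (Y : Matrix (Fin 3) (Fin 3) R) :
    -(!![(0 : R), 0, 1; 0, 1, 0; 1, 0, 0] * ((r • Y).map σ)ᵀ * !![(0 : R), 0, 1; 0, 1, 0; 1, 0, 0]) =
      σ r • -(!![(0 : R), 0, 1; 0, 1, 0; 1, 0, 0] * (Y.map σ)ᵀ * !![(0 : R), 0, 1; 0, 1, 0; 1, 0, 0]) := by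
  have hms : (r • Y).map σ = σ r • Y.map σ := by
    ext i j
    simp
  rw [hms, Matrix.transpose_smul, Matrix.mul_smul, Matrix.smul_mul, smul_neg]

/-- The unitary Lie algebra = the `θ`-FIXED points: `ᵗ(σX) J₃ + J₃ X = 0 ↔ θ X = X`. [cite: Rogawski1990, §1.9 p. 8] -/
theorem mem_iff_theta_eq (X : Matrix (Fin 3) (Fin 3) R) :
    (X.map σ)ᵀ * !![(0 : R), 0, 1; 0, 1, 0; 1, 0, 0] + !![(0 : R), 0, 1; 0, 1, 0; 1, 0, 0] * X = 0 ↔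
      -(!![(0 : R), 0, 1; 0, 1, 0; 1, 0, 0] * (X.map σ)ᵀ * !![(0 : R), 0, 1; 0, 1, 0; 1, 0, 0]) = X := by
  have hJ2 := UnitaryThreeWitt.antidiagonal_three_mul_self (E := R)
  constructor
  · intro h
    have h1 : !![(0 : R), 0, 1; 0, 1, 0; 1, 0, 0] * (X.map σ)ᵀ * !![(0 : R), 0, 1; 0, 1, 0; 1, 0, 0] + X = 0 := by
      have e := congrArg (fun M => !![(0 : R), 0, 1; 0, 1, 0; 1, 0, 0] * M) h
      simpa only [Matrix.mul_add, ← Matrix.mul_assoc, hJ2, Matrix.one_mul, Matrix.mul_zero] using e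
    exact (eq_neg_of_add_eq_zero_right h1).symm
  · intro h
    nth_rw 2 [← h]
    rw [Matrix.mul_neg, ← Matrix.mul_assoc, ← Matrix.mul_assoc, hJ2, Matrix.one_mul, add_neg_cancel]

/-- The model nilpotent is `θ`-fixed: `σ c = −c ⇒ θ (c·E₀₂) = c·E₀₂`. [cite: Rogawski1990, §1.9 p. 8] -/
theorem theta_single_zero_two {c : R} (hc : σ c = -c) :
    -(!![(0 : R), 0, 1; 0, 1, 0; 1, 0, 0] * ((single (0 : Fin 3) (2 : Fin 3) c).map σ)ᵀ * !![(0 : R), 0, 1; 0, 1, 0; 1, 0, 0]) =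
      single (0 : Fin 3) (2 : Fin 3) c := by
  ext i j
  rw [theta_apply]
  fin_cases i <;> fin_cases j <;> simp [Fin.rev, hc]

/-- `θ` PRESERVES THE SHAPE `range (ad E₂₀)` (`Y 0 1 = Y 0 2 = Y 1 1 = Y 1 2 = 0`, `Y 0 0 + Y 2 2 = 0`). [cite: Humphreys1972, §7.2] -/
theorem theta_rangeShape {Y : Matrix (Fin 3) (Fin 3) R} (h : Y 0 1 = 0 ∧ Y 0 2 = 0 ∧ Y 1 1 = 0 ∧ Y 1 2 = 0 ∧ Y 0 0 + Y 2 2 = 0) :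
    (-(!![(0 : R), 0, 1; 0, 1, 0; 1, 0, 0] * (Y.map σ)ᵀ * !![(0 : R), 0, 1; 0, 1, 0; 1, 0, 0])) 0 1 = 0 ∧
      (-(!![(0 : R), 0, 1; 0, 1, 0; 1, 0, 0] * (Y.map σ)ᵀ * !![(0 : R), 0, 1; 0, 1, 0; 1, 0, 0])) 0 2 = 0 ∧
      (-(!![(0 : R), 0, 1; 0, 1, 0; 1, 0, 0] * (Y.map σ)ᵀ * !![(0 : R), 0, 1; 0, 1, 0; 1, 0, 0])) 1 1 = 0 ∧
      (-(!![(0 : R), 0, 1; 0, 1, 0; 1, 0, 0] * (Y.map σ)ᵀ * !![(0 : R), 0, 1; 0, 1, 0; 1, 0, 0])) 1 2 = 0 ∧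
      (-(!![(0 : R), 0, 1; 0, 1, 0; 1, 0, 0] * (Y.map σ)ᵀ * !![(0 : R), 0, 1; 0, 1, 0; 1, 0, 0])) 0 0 +
        (-(!![(0 : R), 0, 1; 0, 1, 0; 1, 0, 0] * (Y.map σ)ᵀ * !![(0 : R), 0, 1; 0, 1, 0; 1, 0, 0])) 2 2 = 0 := by
  obtain ⟨h01, h02, h11, h12, htr⟩ := h
  have r0 : (0 : Fin 3).rev = 2 := rfl
  have r1 : (1 : Fin 3).rev = 1 := rfl
  have r2 : (2 : Fin 3).rev = 0 := rfl
  simp only [theta_apply, r0, r1, r2, h01, h02, h11, h12, map_zero, neg_zero]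
  refine ⟨trivial, trivial, trivial, trivial, ?_⟩
  have e : Y 2 2 = -Y 0 0 := by linear_combination htr
  rw [e, map_neg]
  ring

/-- `θ` PRESERVES THE CENTRALISER `𝔷(E₂₀)`. [cite: Humphreys1972, §7.2] -/
theorem theta_comm_single_two_zero {Z : Matrix (Fin 3) (Fin 3) R}
    (hZ : Z * single (2 : Fin 3) (0 : Fin 3) (1 : R) = single (2 : Fin 3) (0 : Fin 3) 1 * Z) :
    (-(!![(0 : R), 0, 1; 0, 1, 0; 1, 0, 0] * (Z.map σ)ᵀ * !![(0 : R), 0, 1; 0, 1, 0; 1, 0, 0])) * single (2 : Fin 3) (0 : Fin 3) (1 : R) =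
      single (2 : Fin 3) (0 : Fin 3) 1 * (-(!![(0 : R), 0, 1; 0, 1, 0; 1, 0, 0] * (Z.map σ)ᵀ * !![(0 : R), 0, 1; 0, 1, 0; 1, 0, 0])) := by
  obtain ⟨h01, h02, h12, h0022⟩ := (commute_single_two_zero_iff Z).mp hZ
  have r0 : (0 : Fin 3).rev = 2 := rfl
  have r1 : (1 : Fin 3).rev = 1 := rfl
  have r2 : (2 : Fin 3).rev = 0 := rfl
  rw [commute_single_two_zero_iff]
  simp only [theta_apply, r0, r1, r2, h01, h02, h12, h0022, map_zero, neg_zero]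
  exact ⟨trivial, trivial, trivial, trivial⟩

end Theta

/-! ## §2 The descent of the slice chart to `𝔲₀` -/

section Descent

variable {K : Type*} [Field K] (σ : K →+* K) (hσ : ∀ x, σ (σ x) = x) (h2 : (2 : K) ≠ 0) {c : K} (hc : σ c = -c) (hc0 : c ≠ 0)
  (𝔲₀ Q C : AddSubgroup (Matrix (Fin 3) (Fin 3) K))
  (h𝔲₀ : ∀ X, X ∈ 𝔲₀ ↔ (X.map σ)ᵀ * !![(0 : K), 0, 1; 0, 1, 0; 1, 0, 0] + !![(0 : K), 0, 1; 0, 1, 0; 1, 0, 0] * X = 0 ∧ Matrix.trace X = 0)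
  (hQ : ∀ Y, Y ∈ Q ↔ Y ∈ 𝔲₀ ∧ (Y 0 1 = 0 ∧ Y 0 2 = 0 ∧ Y 1 1 = 0 ∧ Y 1 2 = 0 ∧ Y 0 0 + Y 2 2 = 0))
  (hC : ∀ Z, Z ∈ C ↔ Z ∈ 𝔲₀ ∧ Z * single (2 : Fin 3) (0 : Fin 3) (1 : K) = single (2 : Fin 3) (0 : Fin 3) 1 * Z)

include hc h𝔲₀ in
/-- The bracket part of the chart lands in `𝔲₀`: `Y ∈ 𝔲₀ ⇒ 2 • (N Y − Y N) ∈ 𝔲₀` (`N = c·E₀₂`, `σ c = −c`). [cite: Rogawski1990, §1.9 p. 8] -/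
theorem smul_bracket_mem {Y : Matrix (Fin 3) (Fin 3) K} (hY : Y ∈ 𝔲₀) :
    (2 : K) • (single (0 : Fin 3) (2 : Fin 3) c * Y - Y * single (0 : Fin 3) (2 : Fin 3) c) ∈ 𝔲₀ := by
  obtain ⟨hYs, hYt⟩ := (h𝔲₀ Y).mp hY
  have hθY := (mem_iff_theta_eq σ Y).mp hYs
  have hθN := theta_single_zero_two σ hc
  refine (h𝔲₀ _).mpr ⟨?_, ?_⟩
  · rw [mem_iff_theta_eq, theta_smul, map_ofNat, theta_sub, theta_mul, theta_mul, hθY, hθN]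
    congr 1
    abel
  · rw [Matrix.trace_smul, Matrix.trace_sub, Matrix.trace_mul_comm, sub_self, smul_zero]

include h2 hc0 hQ hC in
/-- INJECTIVITY of the descended chart: `2 • (N Y − Y N) + Z = 2 • (N Y′ − Y′ N) + Z′` with `Y, Y′ ∈ Q`, `Z, Z′ ∈ C` forces `Y = Y′`, `Z = Z′`
(★ (D) `bracket_eq_zero_of_commute_single_two_zero` + `eq_zero_of_mem_range_of_bracket_eq_zero`). [cite: Humphreys1972, §7.2] -/
theorem slice_injective {Y Y' Z Z' : Matrix (Fin 3) (Fin 3) K} (hY : Y ∈ Q) (hY' : Y' ∈ Q) (hZ : Z ∈ C) (hZ' : Z' ∈ C)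
    (h : (2 : K) • (single (0 : Fin 3) (2 : Fin 3) c * Y - Y * single (0 : Fin 3) (2 : Fin 3) c) + Z =
      (2 : K) • (single (0 : Fin 3) (2 : Fin 3) c * Y' - Y' * single (0 : Fin 3) (2 : Fin 3) c) + Z') :
    Y = Y' ∧ Z = Z' := by
  have h2u : IsUnit (2 : K) := isUnit_iff_ne_zero.mpr h2
  have hcu : IsUnit c := isUnit_iff_ne_zero.mpr hc0
  -- `D := Y − Y'` has the range shape, `W := Z' − Z` commutes with `E₂₀`, and `2 • (D N − N D) = Z' − Z`
  obtain ⟨-, hDshape⟩ := (hQ _).mp (Q.sub_mem hY hY')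
  obtain ⟨-, hWcomm⟩ := (hC _).mp (C.sub_mem hZ' hZ)
  have hAB : (2 : K) • (single (0 : Fin 3) (2 : Fin 3) c * Y - Y * single (0 : Fin 3) (2 : Fin 3) c) - (2 : K) • (single (0 : Fin 3) (2 : Fin 3) c * Y' - Y' * single (0 : Fin 3) (2 : Fin 3) c) = Z' - Z :=
    sub_eq_sub_iff_add_eq_add.mpr (h.trans (add_comm _ _))
  have hDW : (2 : K) • (single (0 : Fin 3) (2 : Fin 3) c * (Y - Y') - (Y - Y') * single (0 : Fin 3) (2 : Fin 3) c) = Z' - Z := by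
    rw [← hAB]
    simp only [sub_mul, mul_sub, smul_sub]
    abel
  -- hence `N D − D N = 2⁻¹ • (Z' − Z)` commutes with `E₂₀`, so it vanishes (★ (D) §4), and then `D = 0` (★ (D) §6)
  have hbr : single (0 : Fin 3) (2 : Fin 3) c * (Y - Y') - (Y - Y') * single (0 : Fin 3) (2 : Fin 3) c = (2 : K)⁻¹ • (Z' - Z) := by
    rw [← hDW, smul_smul, inv_mul_cancel₀ h2, one_smul]
  have hcomm : (single (0 : Fin 3) (2 : Fin 3) c * (Y - Y') - (Y - Y') * single (0 : Fin 3) (2 : Fin 3) c) * single (2 : Fin 3) (0 : Fin 3) (1 : K) =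
      single (2 : Fin 3) (0 : Fin 3) 1 * (single (0 : Fin 3) (2 : Fin 3) c * (Y - Y') - (Y - Y') * single (0 : Fin 3) (2 : Fin 3) c) := by
    rw [hbr, Matrix.smul_mul, Matrix.mul_smul, hWcomm]
  have hzero := bracket_eq_zero_of_commute_single_two_zero h2u c (Y - Y') hcomm
  obtain ⟨s01, s02, s11, s12, str⟩ := hDshape
  have hD0 : Y - Y' = 0 := eq_zero_of_mem_range_of_bracket_eq_zero hcu h2u s01 s02 s11 s12 str hzero
  refine ⟨sub_eq_zero.mp hD0, ?_⟩
  have hW0 : Z' - Z = 0 := by rw [← hDW, hD0, Matrix.zero_mul, Matrix.mul_zero, sub_zero, smul_zero]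
  exact (sub_eq_zero.mp hW0).symm

include h2 hc hc0 h𝔲₀ hQ hC in
/-- SURJECTIVITY of the descended chart: every `X ∈ 𝔲₀` is `2 • (N Y − Y N) + Z` with `Y ∈ Q`, `Z ∈ C` (decompose over `K` by ★ (D) §6, then `θ`-uniqueness).
[cite: Humphreys1972, §7.2] -/
theorem slice_surjective {X : Matrix (Fin 3) (Fin 3) K} (hX : X ∈ 𝔲₀) :
    ∃ Y Z : Matrix (Fin 3) (Fin 3) K, Y ∈ Q ∧ Z ∈ C ∧
      X = (2 : K) • (single (0 : Fin 3) (2 : Fin 3) c * Y - Y * single (0 : Fin 3) (2 : Fin 3) c) + Z := by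
  have h2u : IsUnit (2 : K) := isUnit_iff_ne_zero.mpr h2
  have hcu : IsUnit c := isUnit_iff_ne_zero.mpr hc0
  obtain ⟨hXs, hXt⟩ := (h𝔲₀ X).mp hX
  have hθX := (mem_iff_theta_eq σ X).mp hXs
  have hθN := theta_single_zero_two σ hc
  -- decompose over `K` (★ (D) §6): `X = (N A − A N) + W`, `A` of range shape, `W ∈ 𝔷(E₂₀)`
  obtain ⟨A, W, hA, hW, hXeq⟩ := exists_mem_range_bracket_add_centralizer (Units.mk0 c hc0) h2u X
  rw [Units.val_mk0] at hXeq
  -- apply `θ`: `X = (N θA − θA N) + θW`, and uniqueness of the decomposition forces `θA = A`, `θW = W`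
  have hθA := theta_rangeShape σ hA
  have hθW := theta_comm_single_two_zero σ hW
  have hXeq' : X = (single (0 : Fin 3) (2 : Fin 3) c * (-(!![(0 : K), 0, 1; 0, 1, 0; 1, 0, 0] * (A.map σ)ᵀ * !![(0 : K), 0, 1; 0, 1, 0; 1, 0, 0])) - (-(!![(0 : K), 0, 1; 0, 1, 0; 1, 0, 0] * (A.map σ)ᵀ * !![(0 : K), 0, 1; 0, 1, 0; 1, 0, 0])) * single (0 : Fin 3) (2 : Fin 3) c) +
      (-(!![(0 : K), 0, 1; 0, 1, 0; 1, 0, 0] * (W.map σ)ᵀ * !![(0 : K), 0, 1; 0, 1, 0; 1, 0, 0])) := by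
    conv_lhs => rw [← hθX, hXeq]
    rw [theta_add, theta_bracket σ hθN]
  -- the difference `A − θA` has the range shape and its bracket with `N` commutes with `E₂₀`
  set D := A - -(!![(0 : K), 0, 1; 0, 1, 0; 1, 0, 0] * (A.map σ)ᵀ * !![(0 : K), 0, 1; 0, 1, 0; 1, 0, 0]) with hDdef
  have hDshape : D 0 1 = 0 ∧ D 0 2 = 0 ∧ D 1 1 = 0 ∧ D 1 2 = 0 ∧ D 0 0 + D 2 2 = 0 := by
    obtain ⟨a1, a2, a3, a4, a5⟩ := hA
    obtain ⟨b1, b2, b3, b4, b5⟩ := hθA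
    refine ⟨?_, ?_, ?_, ?_, ?_⟩ <;> simp only [hDdef, Matrix.sub_apply, a1, a2, a3, a4, b1, b2, b3, b4, sub_zero]
    linear_combination a5 - b5
  have hbr : single (0 : Fin 3) (2 : Fin 3) c * D - D * single (0 : Fin 3) (2 : Fin 3) c = -(!![(0 : K), 0, 1; 0, 1, 0; 1, 0, 0] * (W.map σ)ᵀ * !![(0 : K), 0, 1; 0, 1, 0; 1, 0, 0]) - W := by
    have e := hXeq.symm.trans hXeq'
    rw [hDdef, Matrix.mul_sub, Matrix.sub_mul]
    rw [← sub_eq_zero] at e ⊢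
    rw [← e]
    abel
  have hcomm : (single (0 : Fin 3) (2 : Fin 3) c * D - D * single (0 : Fin 3) (2 : Fin 3) c) * single (2 : Fin 3) (0 : Fin 3) (1 : K) = single (2 : Fin 3) (0 : Fin 3) 1 * (single (0 : Fin 3) (2 : Fin 3) c * D - D * single (0 : Fin 3) (2 : Fin 3) c) := by
    rw [hbr, Matrix.sub_mul, Matrix.mul_sub, hθW, hW]
  have hzero := bracket_eq_zero_of_commute_single_two_zero h2u c D hcomm
  obtain ⟨s01, s02, s11, s12, str⟩ := hDshape
  have hD0 : D = 0 := eq_zero_of_mem_range_of_bracket_eq_zero hcu h2u s01 s02 s11 s12 str hzero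
  have hθA' : -(!![(0 : K), 0, 1; 0, 1, 0; 1, 0, 0] * (A.map σ)ᵀ * !![(0 : K), 0, 1; 0, 1, 0; 1, 0, 0]) = A := (sub_eq_zero.mp (hDdef ▸ hD0)).symm
  have hθW' : -(!![(0 : K), 0, 1; 0, 1, 0; 1, 0, 0] * (W.map σ)ᵀ * !![(0 : K), 0, 1; 0, 1, 0; 1, 0, 0]) = W := by
    have e := hbr
    rw [hD0, Matrix.mul_zero, Matrix.zero_mul, sub_zero] at e
    exact (sub_eq_zero.mp e.symm).symm ▸ rfl
  -- memberships
  have hAtr : Matrix.trace A = 0 := by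
    obtain ⟨-, -, a3, -, a5⟩ := hA
    rw [Matrix.trace_fin_three, a3, add_zero, a5]
  have hWtr : Matrix.trace W = 0 := by rw [trace_eq_of_eq_bracket_add hXeq, hXt]
  have hAu : A ∈ 𝔲₀ := (h𝔲₀ A).mpr ⟨(mem_iff_theta_eq σ A).mpr hθA', hAtr⟩
  have hWu : W ∈ 𝔲₀ := (h𝔲₀ W).mpr ⟨(mem_iff_theta_eq σ W).mpr hθW', hWtr⟩
  -- `Y := 2⁻¹ • A ∈ Q`
  have hYθ : -(!![(0 : K), 0, 1; 0, 1, 0; 1, 0, 0] * ((((2 : K)⁻¹) • A).map σ)ᵀ * !![(0 : K), 0, 1; 0, 1, 0; 1, 0, 0]) = ((2 : K)⁻¹) • A := by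
    rw [theta_smul, hθA', map_inv₀, map_ofNat]
  have hYtr : Matrix.trace (((2 : K)⁻¹) • A) = 0 := by rw [Matrix.trace_smul, hAtr, smul_zero]
  have hYshape : (((2 : K)⁻¹) • A) 0 1 = 0 ∧ (((2 : K)⁻¹) • A) 0 2 = 0 ∧ (((2 : K)⁻¹) • A) 1 1 = 0 ∧ (((2 : K)⁻¹) • A) 1 2 = 0 ∧
      (((2 : K)⁻¹) • A) 0 0 + (((2 : K)⁻¹) • A) 2 2 = 0 := by
    obtain ⟨a1, a2, a3, a4, a5⟩ := hA
    simp only [Matrix.smul_apply, smul_eq_mul, a1, a2, a3, a4, mul_zero, ← mul_add, a5, and_self]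
  have hY : ((2 : K)⁻¹) • A ∈ Q := (hQ _).mpr ⟨(h𝔲₀ _).mpr ⟨(mem_iff_theta_eq σ _).mpr hYθ, hYtr⟩, hYshape⟩
  refine ⟨((2 : K)⁻¹) • A, W, hY, (hC W).mpr ⟨hWu, hW⟩, ?_⟩
  rw [hXeq, Matrix.smul_mul, Matrix.mul_smul, ← smul_sub, smul_smul, mul_inv_cancel₀ h2, one_smul]

include h2 hc hc0 h𝔲₀ hQ hC in
/-- **THE DESCENDED SLODOWY CHART** (∃-bundle, no definition): an additive equivalence `e : Q × C ≃+ 𝔲₀` with `e (Y, Z) = 2 • (N Y − Y N) + Z`, `N = c·E₀₂`.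
[cite: Humphreys1972, §7.2] [cite: Rogawski1990, §1.9 p. 8] -/
theorem exists_slice_addEquiv :
    ∃ e : (↥Q × ↥C) ≃+ ↥𝔲₀, ∀ p : ↥Q × ↥C,
      ((e p : ↥𝔲₀) : Matrix (Fin 3) (Fin 3) K) =
        (2 : K) • (single (0 : Fin 3) (2 : Fin 3) c * (p.1 : Matrix (Fin 3) (Fin 3) K) - (p.1 : Matrix (Fin 3) (Fin 3) K) * single (0 : Fin 3) (2 : Fin 3) c) +
          (p.2 : Matrix (Fin 3) (Fin 3) K) := by
  -- the chart as an additive homomorphism into `𝔲₀`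
  let f : (↥Q × ↥C) →+ ↥𝔲₀ :=
    { toFun := fun p => ⟨(2 : K) • (single (0 : Fin 3) (2 : Fin 3) c * (p.1 : Matrix (Fin 3) (Fin 3) K) - (p.1 : Matrix (Fin 3) (Fin 3) K) * single (0 : Fin 3) (2 : Fin 3) c) +
          (p.2 : Matrix (Fin 3) (Fin 3) K),
        𝔲₀.add_mem (smul_bracket_mem σ hc 𝔲₀ h𝔲₀ ((hQ _).mp p.1.2).1) ((hC _).mp p.2.2).1⟩
      map_zero' := by
        ext i j
        simp
      map_add' := fun p q => by
        ext i j
        simp only [Prod.fst_add, Prod.snd_add, AddSubgroup.coe_add, Matrix.add_mul, Matrix.mul_add, smul_add, smul_sub,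
          Matrix.add_apply, Matrix.sub_apply, Matrix.smul_apply]
        ring }
  have hinj : Function.Injective f := by
    rintro ⟨⟨Y, hY⟩, ⟨Z, hZ⟩⟩ ⟨⟨Y', hY'⟩, ⟨Z', hZ'⟩⟩ hpq
    have e := congrArg Subtype.val hpq
    obtain ⟨h1, h2'⟩ := slice_injective h2 hc0 𝔲₀ Q C hQ hC hY hY' hZ hZ' e
    subst h1 h2'
    rfl
  have hsurj : Function.Surjective f := by
    rintro ⟨X, hX⟩
    obtain ⟨Y, Z, hY, hZ, hx⟩ := slice_surjective σ h2 hc hc0 𝔲₀ Q C h𝔲₀ hQ hC hX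
    exact ⟨(⟨Y, hY⟩, ⟨Z, hZ⟩), Subtype.ext hx.symm⟩
  exact ⟨AddEquiv.ofBijective f ⟨hinj, hsurj⟩, fun p => rfl⟩

end Descent

end Literature.LinearAlgebra.Matrix.UnitaryThreeSliceDescent
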